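import Literature.Algebra.Lie.JacobsonMorozov
import Literature.Algebra.Lie.LefschetzTriple
import Literature.Algebra.Lie.ReductiveSplitting
import Mathlib.Algebra.Lie.Graded
import Mathlib.LinearAlgebra.Eigenspace.Pi
import Mathlib.Algebra.DirectSum.Module
import HarnessLib

/-!
# The graded Jacobson–Morozov lemma (Looijenga–Lunts 1997, §5 (5.2))

Topic `Literature/Algebra/Lie` (namespace `Literature.Algebra.Lie`).  Lane `lit-hodgefound` (Track 2 foundations
library), skeleton seat `lit-hodgefound-skel-1` (generation 46), row **A1-145** of
`run/shared/lean/pub/lit-hodgefound/SKELETON.md`: Looijenga–Lunts' Lemma (5.2) — in a semisimple Lie algebra graded by the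
weights of a commuting family of semisimple elements, a nilpotent `e` of weight `χ` lies in an `𝔰𝔩₂`-triple
`(e, [e, f], f)` with `f` of weight `-χ` — with the PRINTED PROOF (components of an arbitrary Jacobson–Morozov triple,
then Bourbaki VIII §11 Lemma 6), on top of the tree's `JacobsonMorozov.lean` (`exists_isSl2Triple_of_isNilpotent_ad` =
Bourbaki VIII §11 Prop. 2, `exists_isSl2Triple_of_lie_eq_two_smul_of_mem_range_ad'` = Lemma 6) and A1-84's `adDegree`
(`LefschetzTriple.lean`) and the tree's `ReductiveSplitting.lean` (Bourbaki I §6 no. 4: `𝒟𝔤` of a reductive `𝔤` is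
semisimple).  THEOREMS ONLY: no definition, no named fact, no `sorry`, no instance, no notation (D-0026 net
debt `0`); Mathlib vocabulary (`IsSl2Triple`, `LieAlgebra.ad`, `Module.End.eigenspace`, `DirectSum.IsInternal`,
`DirectSum.decompose`, `GradedLieAlgebra`, `LieAlgebra.HasTrivialRadical`, `LieAlgebra.HasCentralRadical`,
`LieAlgebra.derivedSeries`).

## Source, VERBATIM

E. Looijenga, V. A. Lunts, *A Lie algebra attached to a projective variety*, Invent. Math. **129** (1997) 361–412,
§5 "Filtered Lefschetz modules" (held TeX text `paper:arxiv-alg-geom_9604014`), (5.2) Lemma, p0020 L108–L121: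

> "**Lemma.** Let `𝔤` be a reductive Lie algebra, `𝔰 ⊂ 𝔤` a commutative subalgebra consisting of semisimple elements
> and `χ ∈ 𝔰^*` a character of `𝔰` in `𝔤`. Then for every nilpotent `e ∈ 𝔤^χ` there exists a `f ∈ 𝔤^{-χ}` such that
> `(e, [e, f], f)` is an `𝔰𝔩(2)`-triple.
> *Proof.* Choose an `𝔰𝔩₂`-triple `(e, h', f')` containing `e`. Let `f''` be the `𝔤^{-χ}`-component of `f'`. Then
> `h := [e, f'']` is the `𝔤^0`-component of `h'` and so `[h, e]` is the `𝔤^χ`-component of `[h', e] = 2e` and hence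
> equal to `2e`. Since `h` is in the image of `ad(e)`, the pair `(e, h)` is by [Bourbaki], Ch. VIII, 11, Lemme 6,
> extendable to a `𝔰𝔩₂`-triple `(e, h, f)`. This remains an `𝔰𝔩₂`-triple if we replace `f` by its
> `𝔤^{-χ}`-component and so the lemma follows."

and its use in (5.3), p0021 L17–L19: "If we apply 5.2 to `e := e_a` and `𝔰 := ℂh`, we find an `𝔰𝔩₂`-triple
`(e_a, h_hor, f_a)` in `𝔤(𝔞, M)` with `f_a` of total degree `-2` and `h_hor` of total degree `0`."

## Rendering (dictionary)

* "`𝔤` graded by the characters of `𝔰`" is rendered, in §1–§2, by an ABSTRACT grading: a family of subspaces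
  `𝔤 : Γ → Submodule K L` indexed by an additive commutative group `Γ` (the weights), with `L = ⨁_γ 𝔤 γ`
  and `⁅𝔤 α, 𝔤 β⁆ ⊆ 𝔤 (α + β)` — Mathlib's class `GradedLieAlgebra 𝔤` (= `SetLike.GradedBracket` + `DirectSum.Decomposition`),
  or the `Prop`-level pair `DirectSum.IsInternal 𝔤` + `hmul`; "the `𝔤^γ`-component of `x`" is Mathlib's
  `DirectSum.decompose 𝔤 x γ`.  §3–§4 produce this grading from the printed data: ONE split semisimple element `s`
  (`𝔰 = Ks`, `Γ = K`, `𝔤 μ = adDegree K s μ` = the `μ`-eigenspace of `ad s`; "semisimple" = `ad s` diagonalisable over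
  `K`, `⨆ μ, adDegree K s μ = ⊤`) — the case of (5.3) — and a COMMUTING FAMILY `s : ι → L` of such elements
  (`Γ = ι → K`, `𝔤^χ = ⨅ i, adDegree K (s i) (χ i)`, a character of `𝔰 = span s` being determined by its values on `s`).
* "`(e, [e, f], f)` is an `𝔰𝔩(2)`-triple" = Mathlib's `IsSl2Triple ⁅e, f⁆ e f` (`⁅h, e⁆ = 2e`, `⁅h, f⁆ = -2f`, `h ≠ 0`).
* "nilpotent `e`" = `IsNilpotent (LieAlgebra.ad K L e)`; it is automatic when `χ ≠ 0` (§3 `…_of_ne_zero`, from the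
  tree's `isNilpotent_ad_of_lie_eq_two_smul`).
* "reductive" = `LieAlgebra.HasCentralRadical K L` (§6); §2–§5 first treat the semisimple case
  (`LieAlgebra.HasTrivialRadical K L`, finite dimension, characteristic `0`; by Mathlib's Cartan criterion
  `HasTrivialRadical.instIsKilling` this is the hypothesis of the tree's Jacobson–Morozov theorem); see SCOPE (a) for the
  reading of "nilpotent".

## Contents (all proved)

* §1 `coe_decompose_apply_add` (a linear map of degree `χ` commutes with taking components:
  `(T x)_{χ+γ} = T (x_γ)`), `coe_decompose_lie_add` / `coe_decompose_lie_add'` (`⁅e, x⁆_{χ+γ} = ⁅e, x_γ⁆`,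
  `⁅x, e⁆_{γ+χ} = ⁅x_γ, e⁆` for `e ∈ 𝔤 χ`, in a `GradedLieAlgebra 𝔤` of Mathlib), `isSl2Triple_coe_decompose_neg`
  ("this remains an `𝔰𝔩₂`-triple if we replace `f` by its `𝔤^{-χ}`-component").
* §2 **`exists_mem_isSl2Triple_of_isSl2Triple`** — THE GRADED REFINEMENT (the printed proof): in ANY finite-dimensional
  graded Lie algebra over a field of characteristic `0`, an `e ∈ 𝔤 χ` lying in some `𝔰𝔩₂`-triple lies in one
  `(e, [e, f], f)` with `f ∈ 𝔤 (-χ)`; **`exists_mem_isSl2Triple`** — THE GRADED JACOBSON–MOROZOV LEMMA: `L`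
  finite-dimensional semisimple over a field of characteristic `0` with a `GradedLieAlgebra 𝔤` structure (Mathlib:
  `L = ⨁ 𝔤 γ`, `⁅𝔤 α, 𝔤 β⁆ ⊆ 𝔤 (α+β)`), `e ∈ 𝔤 χ`, `e ≠ 0`, `ad e` nilpotent `⟹ ∃ f ∈ 𝔤 (-χ), IsSl2Triple ⁅e, f⁆ e f`;
  `exists_mem_zero_mem_neg_isSl2Triple`;
  `lie_mem_zero_of_mem_of_mem_neg` (`⁅e, f⁆ ∈ 𝔤 0`); the uniqueness complement **`mem_neg_of_isSl2Triple`**: in ANY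
  `𝔰𝔩₂`-triple `(e, h, f)` with `e ∈ 𝔤 χ` and `h ∈ 𝔤 0` the third member automatically lies in `𝔤 (-χ)` (Bourbaki VIII
  §11 Lemma 1, the tree's `IsSl2Triple.f_eq_of_isSl2Triple`); and the same three statements for a grading given by
  `Prop`-level data `DirectSum.IsInternal 𝔤` + `⁅𝔤 α, 𝔤 β⁆ ⊆ 𝔤 (α + β)` (`…_of_isInternal`).
* §3 ONE SEMISIMPLE ELEMENT (`𝔰 = Ks`, the case used in (5.3)): `isInternal_adDegree` (a diagonalisable `ad s` grades
  `L`), **`exists_mem_adDegree_isSl2Triple`** (`e ∈ 𝔤_c` nilpotent `⟹ ∃ f ∈ 𝔤_{-c}`, `(e, [e,f], f)` an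
  `𝔰𝔩₂`-triple), **`exists_mem_adDegree_isSl2Triple_of_ne_zero`** (`c ≠ 0`: no nilpotency hypothesis),
  `isNilpotent_ad_of_mem_adDegree`, `mem_adDegree_neg_of_isSl2Triple` (the weight `-c` of the third member is forced).
* §4 THE PRINTED SETTING, a commuting family `s : ι → L` of diagonalisable elements:
  `maxGenEigenspace_eq_eigenspace_of_iSup_eigenspace_eq_top` (a diagonalisable endomorphism has no generalised
  eigenvectors beyond eigenvectors), `isInternal_iInf_adDegree` (the simultaneous eigenspaces grade `L`, via Mathlib's
  `Module.End.independent_iInf_maxGenEigenspace_of_forall_mapsTo` /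
  `iSup_iInf_maxGenEigenspace_eq_top_of_iSup_maxGenEigenspace_eq_top_of_commute`), `lie_mem_iInf_adDegree`, and
  **`exists_mem_iInf_adDegree_isSl2Triple`** = (5.2) AS PRINTED (split form), with the variants
  `exists_mem_iInf_adDegree_zero_isSl2Triple` (weights of `h` and `f` displayed), `…_of_ne_zero` (a non-zero weight makes
  `e` nilpotent) and `mem_iInf_adDegree_neg_of_isSl2Triple` (the weight of `f` is forced).
* §5 LEFSCHETZ TRIPLES (A1-84): in a Lefschetz triple `(𝔤, h, 𝔞)` every non-zero `x ∈ 𝔤_c`, `c ≠ 0`, is the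
  nil-positive element of an `𝔰𝔩₂`-triple `(x, [x, f], f)` with `f ∈ 𝔤_{-c}`, `[x, f] ∈ 𝔤₀`
  (`IsLefschetzTriple.iSup_adDegree_eq_top`, **`IsLefschetzTriple.exists_mem_adDegree_isSl2Triple`**,
  `IsJordanLefschetzPair.exists_mem_adDegree_isSl2Triple`) — (5.3)'s "`f_a` of total degree `-2` and `h_hor` of total
  degree `0`" for `x = e_a ∈ 𝔤₂`.
* §6 THE PRINTED HYPOTHESIS "REDUCTIVE" (`LieAlgebra.HasCentralRadical`, Mathlib's name for Bourbaki's "reductive",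
  `rad 𝔤 = 𝔷(𝔤)`; the tree's `ReductiveSplitting.lean`: `𝔤 = 𝔷(𝔤) ⊕ 𝒟𝔤`, `𝒟𝔤` semisimple):
  **`exists_isSl2Triple_of_hasCentralRadical`** (Jacobson–Morozov in a reductive `𝔤`: a non-zero `ad`-nilpotent `e ∈ 𝒟𝔤`
  lies in an `𝔰𝔩₂`-triple), `mem_derivedSeries_of_mem_adDegree` (non-zero weight `⟹ e ∈ 𝒟𝔤`),
  **`exists_mem_isSl2Triple_of_hasCentralRadical`** / `…_of_isInternal` ((5.2) for reductive `𝔤` and a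
  `GradedLieAlgebra` / internal grading), **`exists_mem_iInf_adDegree_isSl2Triple_of_hasCentralRadical`** = (5.2)
  VERBATIM (split form) with `…_of_ne_zero` (non-zero weight: no nilpotency / `𝒟𝔤` hypothesis), and
  `exists_mem_adDegree_isSl2Triple_of_hasCentralRadical` (`𝔰 = Ks`).

## SCOPE (what is NOT formalised, and why)

(a) "reductive" / "nilpotent": for a reductive `𝔤 = 𝔷(𝔤) × 𝒟𝔤` a central `z ≠ 0` is `ad`-nilpotent and lies in no
`𝔰𝔩₂`-triple (`e = ½[h, e] ∈ 𝒟𝔤`), so "nilpotent `e`" is read, as usual for reductive Lie algebras, as "`e ∈ 𝒟𝔤`,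
`ad e` nilpotent" (§6; automatic for non-zero weights); §2–§5 state the semisimple case (`HasTrivialRadical`), which is
how (5.3) uses the lemma (`𝔤(𝔞, M)` is semisimple by the definition of a Lefschetz module), §6 the reductive one.
(b) "semisimple elements" of `𝔰` are taken SPLIT (`ad s` diagonalisable over `K`); over `ℂ`, where Looijenga–Lunts work,
this is the same notion.  -- TODO(general form): non-split semisimple `s` (pass to a splitting field).
(c) Nothing here concerns complex tori or the Hodge conjecture; (5.3) itself (filtered Lefschetz modules) is not
formalised here.

## References

* [LooijengaLunts1997] E. Looijenga, V. A. Lunts, *A Lie algebra attached to a projective variety*, Invent. Math. 129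
  (1997) 361–412; arXiv:alg-geom/9604014. §5 (5.2) p. 20 L108–L121, (5.3) p. 21 L17–L19 of the held TeX text.
* [Bourbaki2008LieGroups79] N. Bourbaki, *Lie Groups and Lie Algebras, Chapters 7–9*, Ch. VIII §11 no. 1 Lemma 1,
  no. 2 Lemma 6 and Prop. 2 (pp. 203–206) — via the tree's `JacobsonMorozov.lean`.
* [Bourbaki1989LieGroups13] N. Bourbaki, *Lie Groups and Lie Algebras, Chapters 1–3*, Ch. I §6 no. 4 Def. 4, Prop. 5 —
  via the tree's `ReductiveSplitting.lean`.
* (cf., not used) B. Kostant, S. Rallis, *Orbits and representations associated with symmetric spaces*, Amer. J. Math.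
  93 (1971), Prop. 4; È. B. Vinberg, *The Weyl group of a graded Lie algebra*, Izv. AN SSSR 40 (1976) — the graded
  Jacobson–Morozov lemma for `ℤ/m`-gradings.
-/

namespace Literature.Algebra.Lie

open Module Function Set LieAlgebra

/-! ### §1 Components of a grading -/

section Components

variable {K : Type*} [CommRing K] {L : Type*} [AddCommGroup L] [Module K L]
  {Γ : Type*} [DecidableEq Γ] (𝔤 : Γ → Submodule K L) [DirectSum.Decomposition 𝔤]

/-- Plumbing: "the `i`-component of `y`", `y ↦ (y_i : L)`, is a linear map (`DirectSum.component` after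
`decompose`). [folklore] -/
private theorem coe_decompose_eq_proj (y : L) (i : Γ) :
    (DirectSum.decompose 𝔤 y i : L) =
      ((𝔤 i).subtype ∘ₗ DirectSum.component K Γ (fun j ↦ ↥(𝔤 j)) i ∘ₗ
        (DirectSum.decomposeLinearEquiv 𝔤).toLinearMap) y := rfl

/-- Plumbing: components commute with negation. [folklore] -/
private theorem coe_decompose_apply_neg (y : L) (i : Γ) :
    (DirectSum.decompose 𝔤 (-y) i : L) = -(DirectSum.decompose 𝔤 y i : L) := by
  rw [coe_decompose_eq_proj, coe_decompose_eq_proj, map_neg]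

/-- Plumbing: components commute with scalars. [folklore] -/
private theorem coe_decompose_apply_smul (c : K) (y : L) (i : Γ) :
    (DirectSum.decompose 𝔤 (c • y) i : L) = c • (DirectSum.decompose 𝔤 y i : L) := by
  rw [coe_decompose_eq_proj, coe_decompose_eq_proj, map_smul]

/-- Plumbing: components commute with `ℕ`-multiples. [folklore] -/
private theorem coe_decompose_apply_nsmul (n : ℕ) (y : L) (i : Γ) :
    (DirectSum.decompose 𝔤 (n • y) i : L) = n • (DirectSum.decompose 𝔤 y i : L) := by
  rw [coe_decompose_eq_proj, coe_decompose_eq_proj, map_nsmul]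

variable [AddCommGroup Γ]

/-- **A linear map of degree `χ` commutes with taking components**: if `T (𝔤 γ) ⊆ 𝔤 (χ + γ)` for all `γ`, then the
`(χ + γ)`-component of `T x` is `T` of the `γ`-component of `x` ("Let `f''` be the `𝔤^{-χ}`-component of `f'`. Then
`h := [e, f'']` is the `𝔤^0`-component of `h'`"). [cite: LooijengaLunts1997, §5 (5.2) proof, p. 20 L114–L116] -/
theorem coe_decompose_apply_add (T : L →ₗ[K] L) {χ : Γ} (hT : ∀ γ, ∀ x ∈ 𝔤 γ, T x ∈ 𝔤 (χ + γ)) (x : L) (γ : Γ) :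
    (DirectSum.decompose 𝔤 (T x) (χ + γ) : L) = T (DirectSum.decompose 𝔤 x γ) := by
  classical
  rw [coe_decompose_eq_proj 𝔤 (T x)]
  conv_lhs => rw [← DirectSum.sum_support_decompose 𝔤 x]
  rw [map_sum T, map_sum, Finset.sum_eq_single γ]
  · rw [← coe_decompose_eq_proj]
    exact DirectSum.decompose_of_mem_same 𝔤 (hT γ _ (DirectSum.decompose 𝔤 x γ).2)
  · intro γ' _ hne
    rw [← coe_decompose_eq_proj]
    exact DirectSum.decompose_of_mem_ne 𝔤 (hT γ' _ (DirectSum.decompose 𝔤 x γ').2) fun h ↦ hne (add_left_cancel h)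
  · intro hγ
    have h0 : DirectSum.decompose 𝔤 x γ = 0 := DFinsupp.notMem_support_iff.1 hγ
    rw [h0, ZeroMemClass.coe_zero, map_zero, map_zero]

end Components

section LieComponents

variable {K : Type*} [CommRing K] {L : Type*} [LieRing L] [LieAlgebra K L]
  {Γ : Type*} [DecidableEq Γ] [AddCommGroup Γ] (𝔤 : Γ → Submodule K L) [GradedLieAlgebra 𝔤]

/-- `⁅e, x⁆_{χ+γ} = ⁅e, x_γ⁆` for `e ∈ 𝔤 χ` in a graded Lie algebra (Mathlib `GradedLieAlgebra 𝔤`: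
`L = ⨁_γ 𝔤 γ`, `⁅𝔤 α, 𝔤 β⁆ ⊆ 𝔤 (α + β)`). [cite: LooijengaLunts1997, §5 (5.2) proof, p. 20 L114–L116] -/
theorem coe_decompose_lie_add {χ : Γ} {e : L} (he : e ∈ 𝔤 χ) (x : L) (γ : Γ) :
    (DirectSum.decompose 𝔤 ⁅e, x⁆ (χ + γ) : L) = ⁅e, (DirectSum.decompose 𝔤 x γ : L)⁆ :=
  coe_decompose_apply_add 𝔤 (LieAlgebra.ad K L e)
    (fun _ _ hx ↦ SetLike.GradedBracket.bracket_mem (ℒ := 𝔤) he hx) x γ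

/-- `⁅x, e⁆_{γ+χ} = ⁅x_γ, e⁆` for `e ∈ 𝔤 χ` ("`[h, e]` is the `𝔤^χ`-component of `[h', e]`").
[cite: LooijengaLunts1997, §5 (5.2) proof, p. 20 L115–L117] -/
theorem coe_decompose_lie_add' {χ : Γ} {e : L} (he : e ∈ 𝔤 χ) (x : L) (γ : Γ) :
    (DirectSum.decompose 𝔤 ⁅x, e⁆ (γ + χ) : L) = ⁅(DirectSum.decompose 𝔤 x γ : L), e⁆ := by
  rw [add_comm γ χ, ← lie_skew, coe_decompose_apply_neg, coe_decompose_lie_add 𝔤 he, lie_skew]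

/-- **"This remains an `𝔰𝔩₂`-triple if we replace `f` by its `𝔤^{-χ}`-component"**: if `(e, h, f)` is an
`𝔰𝔩₂`-triple with `e ∈ 𝔤 χ` and `h ∈ 𝔤 0`, then so is `(e, h, f_{-χ})`. [cite: LooijengaLunts1997, §5 (5.2) proof, p. 20 L120–L121] -/
theorem isSl2Triple_coe_decompose_neg {χ : Γ} {h e f : L} (t : IsSl2Triple h e f) (he : e ∈ 𝔤 χ)
    (hh : h ∈ 𝔤 0) : IsSl2Triple h e (DirectSum.decompose 𝔤 f (-χ) : L) where
  h_ne_zero := t.h_ne_zero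
  lie_e_f := by
    rw [← coe_decompose_lie_add 𝔤 he, add_neg_cancel, t.lie_e_f, DirectSum.decompose_of_mem_same 𝔤 hh]
  lie_h_e_nsmul := t.lie_h_e_nsmul
  lie_h_f_nsmul := by
    rw [← zero_add (-χ), ← coe_decompose_lie_add 𝔤 hh, t.lie_h_f_nsmul, coe_decompose_apply_neg,
      coe_decompose_apply_nsmul, zero_add]

end LieComponents

/-! ### §2 The graded Jacobson–Morozov lemma -/

section Graded

variable {K : Type*} [Field K] [CharZero K] {L : Type*} [LieRing L] [LieAlgebra K L] [FiniteDimensional K L]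
  {Γ : Type*} [DecidableEq Γ] [AddCommGroup Γ] (𝔤 : Γ → Submodule K L)

omit [CharZero K] [FiniteDimensional K L] [DecidableEq Γ] in
/-- `⁅e, f⁆ ∈ 𝔤 0` for `e ∈ 𝔤 χ`, `f ∈ 𝔤 (-χ)` ("`h_hor` of total degree `0`"). [cite: LooijengaLunts1997, §5 (5.2)–(5.3), p. 20 L115, p. 21 L17–L19] -/
theorem lie_mem_zero_of_mem_of_mem_neg [SetLike.GradedBracket 𝔤] {χ : Γ} {e f : L} (he : e ∈ 𝔤 χ)
    (hf : f ∈ 𝔤 (-χ)) : ⁅e, f⁆ ∈ 𝔤 0 := by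
  have h1 := SetLike.GradedBracket.bracket_mem (ℒ := 𝔤) he hf
  rwa [add_neg_cancel] at h1

omit [FiniteDimensional K L] in
/-- **The graded refinement of an `𝔰𝔩₂`-triple** (the printed proof of (5.2), which uses semisimplicity only to
produce SOME triple through `e`): in ANY finite-dimensional graded Lie algebra over a field of characteristic `0`
(`GradedLieAlgebra 𝔤`), if `e ∈ 𝔤 χ` lies in an `𝔰𝔩₂`-triple `(e, h', f')`, then it lies in one of the form
`(e, [e, f], f)` with `f ∈ 𝔤 (-χ)` (and `[e, f] ∈ 𝔤 0`).  Printed proof, followed: with `f'' := f'_{-χ}`,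
`h := [e, f''] = h'_0` satisfies `[h, e] = (2e)_χ = 2e` and `h ∈ Im ad e`, so Bourbaki VIII §11 Lemma 6 (the tree's
`exists_isSl2Triple_of_lie_eq_two_smul_of_mem_range_ad'`, valid in every finite-dimensional `L`) extends `(e, h)` to a
triple `(e, h, f)`, and `(e, h, f_{-χ})` is again a triple. [cite: LooijengaLunts1997, §5 (5.2) Lemma, proof, p. 20 L113–L121] -/
theorem exists_mem_isSl2Triple_of_isSl2Triple [FiniteDimensional K L] [GradedLieAlgebra 𝔤] {χ : Γ} {h' e f' : L}
    (t' : IsSl2Triple h' e f') (he : e ∈ 𝔤 χ) : ∃ f ∈ 𝔤 (-χ), IsSl2Triple ⁅e, f⁆ e f := by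
  -- "Let f'' be the 𝔤^{-χ}-component of f'. Then h := [e, f''] is the 𝔤^0-component of h' …"
  have hh0 : (DirectSum.decompose 𝔤 h' 0 : L) = ⁅e, (DirectSum.decompose 𝔤 f' (-χ) : L)⁆ := by
    rw [← t'.lie_e_f, ← add_neg_cancel χ, coe_decompose_lie_add 𝔤 he]
  have hhmem : ⁅e, (DirectSum.decompose 𝔤 f' (-χ) : L)⁆ ∈ 𝔤 0 := by
    rw [← hh0]; exact (DirectSum.decompose 𝔤 h' 0).2
  -- "… and so [h, e] is the 𝔤^χ-component of [h', e] = 2e and hence equal to 2e."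
  have hhe : ⁅⁅e, (DirectSum.decompose 𝔤 f' (-χ) : L)⁆, e⁆ = (2 : K) • e := by
    rw [← hh0, ← coe_decompose_lie_add' 𝔤 he, t'.lie_h_e_smul K, zero_add, coe_decompose_apply_smul,
      DirectSum.decompose_of_mem_same 𝔤 he]
  -- "Since h is in the image of ad(e), the pair (e, h) is by [Bourbaki], Ch. VIII, 11, Lemme 6, extendable to a
  -- 𝔰𝔩₂-triple (e, h, f)."
  obtain ⟨f, t⟩ := exists_isSl2Triple_of_lie_eq_two_smul_of_mem_range_ad' t'.e_ne_zero hhe ⟨_, rfl⟩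
  -- "This remains an 𝔰𝔩₂-triple if we replace f by its 𝔤^{-χ}-component and so the lemma follows."
  have t₁ := isSl2Triple_coe_decompose_neg 𝔤 t he hhmem
  refine ⟨(DirectSum.decompose 𝔤 f (-χ) : L), (DirectSum.decompose 𝔤 f (-χ)).2, ?_⟩
  rwa [t₁.lie_e_f]

/-- **THE GRADED JACOBSON–MOROZOV LEMMA (Looijenga–Lunts (5.2)).**  Let `L` be a finite-dimensional semisimple Lie algebra
over a field of characteristic `0`, graded by an additive group `Γ` (Mathlib `GradedLieAlgebra 𝔤`: `L = ⨁_γ 𝔤 γ`,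
`⁅𝔤 α, 𝔤 β⁆ ⊆ 𝔤 (α + β)`), and let `e ∈ 𝔤 χ` be non-zero with `ad e` nilpotent.  Then there is `f ∈ 𝔤 (-χ)` such that
`(e, [e, f], f)` is an `𝔰𝔩₂`-triple: "Choose an `𝔰𝔩₂`-triple `(e, h', f')` containing `e`" (Jacobson–Morozov, the
tree's `exists_isSl2Triple_of_isNilpotent_ad`) and refine it (`exists_mem_isSl2Triple_of_isSl2Triple`).  For REDUCTIVE
`L`, as printed, see §6. [cite: LooijengaLunts1997, §5 (5.2) Lemma, p. 20 L108–L121] -/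
theorem exists_mem_isSl2Triple [LieAlgebra.HasTrivialRadical K L] [GradedLieAlgebra 𝔤]
    {χ : Γ} {e : L} (he : e ∈ 𝔤 χ) (he0 : e ≠ 0) (hen : IsNilpotent (LieAlgebra.ad K L e)) :
    ∃ f ∈ 𝔤 (-χ), IsSl2Triple ⁅e, f⁆ e f := by
  haveI := LieAlgebra.HasTrivialRadical.instIsKilling K L
  -- "Choose an 𝔰𝔩₂-triple (e, h', f') containing e."
  obtain ⟨h', f', t'⟩ := exists_isSl2Triple_of_isNilpotent_ad he0 hen
  exact exists_mem_isSl2Triple_of_isSl2Triple 𝔤 t' he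

/-- The same, displaying the middle element and its weight: `∃ h ∈ 𝔤 0, ∃ f ∈ 𝔤 (-χ)` with `(e, h, f)` an
`𝔰𝔩₂`-triple ("`h_hor` of total degree `0`", "`f_a` of total degree `-2`").
[cite: LooijengaLunts1997, §5 (5.2) p. 20 L108–L112, (5.3) p. 21 L17–L19] -/
theorem exists_mem_zero_mem_neg_isSl2Triple [LieAlgebra.HasTrivialRadical K L] [GradedLieAlgebra 𝔤]
    {χ : Γ} {e : L} (he : e ∈ 𝔤 χ) (he0 : e ≠ 0) (hen : IsNilpotent (LieAlgebra.ad K L e)) :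
    ∃ h ∈ 𝔤 0, ∃ f ∈ 𝔤 (-χ), IsSl2Triple h e f := by
  obtain ⟨f, hf, t⟩ := exists_mem_isSl2Triple 𝔤 he he0 hen
  exact ⟨⁅e, f⁆, lie_mem_zero_of_mem_of_mem_neg 𝔤 he hf, f, hf, t⟩

/-- **Uniqueness complement**: in ANY `𝔰𝔩₂`-triple `(e, h, f)` of a graded Lie algebra with `e ∈ 𝔤 χ` and `h ∈ 𝔤 0`,
the third member lies in `𝔤 (-χ)` — its `(-χ)`-component completes `(e, h)` to a triple as well
(`isSl2Triple_coe_decompose_neg`), and the third member of an `𝔰𝔩₂`-triple is unique (Bourbaki VIII §11 no. 1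
Lemma 1, the tree's `IsSl2Triple.f_eq_of_isSl2Triple`).
[cite: LooijengaLunts1997, §5 (5.2) proof, p. 20 L120–L121] [cite: Bourbaki2008LieGroups79, Ch. VIII §11 no. 1 Lemma 1] -/
theorem mem_neg_of_isSl2Triple [GradedLieAlgebra 𝔤] {χ : Γ} {h e f : L}
    (t : IsSl2Triple h e f) (he : e ∈ 𝔤 χ) (hh : h ∈ 𝔤 0) : f ∈ 𝔤 (-χ) := by
  rw [IsSl2Triple.f_eq_of_isSl2Triple K t (isSl2Triple_coe_decompose_neg 𝔤 t he hh)]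
  exact (DirectSum.decompose 𝔤 f (-χ)).2

end Graded

/-! #### The same for a grading given by `Prop`-level data (`DirectSum.IsInternal` + bracket compatibility) -/

section Internal

variable {K : Type*} [Field K] [CharZero K] {L : Type*} [LieRing L] [LieAlgebra K L] [FiniteDimensional K L]
  {Γ : Type*} [DecidableEq Γ] [AddCommGroup Γ] {𝔤 : Γ → Submodule K L}

/-- (5.2) for a grading given as an INTERNAL DIRECT SUM `L = ⨁_γ 𝔤 γ` (`DirectSum.IsInternal 𝔤`) with
`⁅𝔤 α, 𝔤 β⁆ ⊆ 𝔤 (α + β)`: `e ∈ 𝔤 χ` non-zero `ad`-nilpotent `⟹ ∃ f ∈ 𝔤 (-χ)`, `(e, [e, f], f)` an `𝔰𝔩₂`-triple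
(the `GradedLieAlgebra` structure is conjured from the internal direct sum, Mathlib
`DirectSum.IsInternal.chooseDecomposition`). [cite: LooijengaLunts1997, §5 (5.2) Lemma, p. 20 L108–L121] -/
theorem exists_mem_isSl2Triple_of_isInternal [LieAlgebra.HasTrivialRadical K L] (hint : DirectSum.IsInternal 𝔤)
    (hmul : ∀ α β : Γ, ∀ x ∈ 𝔤 α, ∀ y ∈ 𝔤 β, ⁅x, y⁆ ∈ 𝔤 (α + β))
    {χ : Γ} {e : L} (he : e ∈ 𝔤 χ) (he0 : e ≠ 0) (hen : IsNilpotent (LieAlgebra.ad K L e)) :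
    ∃ f ∈ 𝔤 (-χ), IsSl2Triple ⁅e, f⁆ e f := by
  letI : GradedLieAlgebra 𝔤 :=
    { toDecomposition := hint.chooseDecomposition, bracket_mem := @fun α β x y hx hy ↦ hmul α β x hx y hy }
  exact exists_mem_isSl2Triple 𝔤 he he0 hen

/-- … with the weights of `h` and `f` displayed. [cite: LooijengaLunts1997, §5 (5.2) Lemma, p. 20 L108–L121] -/
theorem exists_mem_zero_mem_neg_isSl2Triple_of_isInternal [LieAlgebra.HasTrivialRadical K L]
    (hint : DirectSum.IsInternal 𝔤) (hmul : ∀ α β : Γ, ∀ x ∈ 𝔤 α, ∀ y ∈ 𝔤 β, ⁅x, y⁆ ∈ 𝔤 (α + β))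
    {χ : Γ} {e : L} (he : e ∈ 𝔤 χ) (he0 : e ≠ 0) (hen : IsNilpotent (LieAlgebra.ad K L e)) :
    ∃ h ∈ 𝔤 0, ∃ f ∈ 𝔤 (-χ), IsSl2Triple h e f := by
  letI : GradedLieAlgebra 𝔤 :=
    { toDecomposition := hint.chooseDecomposition, bracket_mem := @fun α β x y hx hy ↦ hmul α β x hx y hy }
  exact exists_mem_zero_mem_neg_isSl2Triple 𝔤 he he0 hen

/-- … and the uniqueness complement for an internal grading. [cite: LooijengaLunts1997, §5 (5.2) proof, p. 20 L120–L121] -/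
theorem mem_neg_of_isSl2Triple_of_isInternal (hint : DirectSum.IsInternal 𝔤)
    (hmul : ∀ α β : Γ, ∀ x ∈ 𝔤 α, ∀ y ∈ 𝔤 β, ⁅x, y⁆ ∈ 𝔤 (α + β))
    {χ : Γ} {h e f : L} (t : IsSl2Triple h e f) (he : e ∈ 𝔤 χ) (hh : h ∈ 𝔤 0) : f ∈ 𝔤 (-χ) := by
  letI : GradedLieAlgebra 𝔤 :=
    { toDecomposition := hint.chooseDecomposition, bracket_mem := @fun α β x y hx hy ↦ hmul α β x hx y hy }
  exact mem_neg_of_isSl2Triple 𝔤 t he hh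

end Internal

/-! ### §3 One semisimple element: the grading of `L` by the eigenvalues of `ad s` (`𝔰 = Ks`, as in (5.3)) -/

section OneElement

variable {K : Type*} [Field K] [CharZero K] {L : Type*} [LieRing L] [LieAlgebra K L] [FiniteDimensional K L]

omit [CharZero K] [FiniteDimensional K L] in
/-- A split semisimple `s ∈ L` — `ad s` diagonalisable over `K`, `⨆ μ, 𝔤_μ = L` — GRADES `L`: `L = ⨁_μ adDegree K s μ`
(with `⁅𝔤_a, 𝔤_b⁆ ⊆ 𝔤_{a+b}`, A1-84 `lie_mem_adDegree`); the eigenspaces of an endomorphism are independent (Mathlib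
`Module.End.eigenspaces_iSupIndep`). [cite: LooijengaLunts1997, §5 (5.2) p. 20 L109–L110 ("𝔰 … consisting of semisimple elements")] -/
theorem isInternal_adDegree [DecidableEq K] {s : L} (hdiag : ⨆ μ : K, adDegree K s μ = ⊤) :
    DirectSum.IsInternal fun μ : K ↦ adDegree K s μ :=
  DirectSum.isInternal_submodule_of_iSupIndep_of_iSup_eq_top (LieAlgebra.ad K L s).eigenspaces_iSupIndep hdiag

/-- An element of non-zero `ad s`-degree is `ad`-nilpotent: if `⁅s, e⁆ = c • e` with `c ≠ 0` then `ad e` is nilpotent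
(rescale `s`: `⁅(2/c) s, e⁆ = 2e`, and use the tree's `isNilpotent_ad_of_lie_eq_two_smul`).
[cite: LooijengaLunts1997, §5 (5.2) p. 20 L111 ("for every nilpotent e ∈ 𝔤^χ")] -/
theorem isNilpotent_ad_of_mem_adDegree {s e : L} {c : K} (hc : c ≠ 0) (he : e ∈ adDegree K s c) :
    IsNilpotent (LieAlgebra.ad K L e) := by
  have h1 : ⁅(2 / c) • s, e⁆ = (2 : K) • e := by
    rw [smul_lie, mem_adDegree_iff.1 he, smul_smul, div_mul_cancel₀ _ hc]
  exact isNilpotent_ad_of_lie_eq_two_smul h1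

/-- **(5.2) for `𝔰 = Ks`** (the case of (5.3)): `L` finite-dimensional semisimple (characteristic `0`), `s ∈ L` with
`ad s` diagonalisable over `K`, and `e ∈ 𝔤_c = adDegree K s c` non-zero with `ad e` nilpotent `⟹` there is
`f ∈ 𝔤_{-c}` with `(e, [e, f], f)` an `𝔰𝔩₂`-triple (so `[e, f] ∈ 𝔤₀`). [cite: LooijengaLunts1997, §5 (5.2) Lemma p. 20 L108–L121, (5.3) p. 21 L17–L19] -/
theorem exists_mem_adDegree_isSl2Triple [LieAlgebra.HasTrivialRadical K L] {s : L}
    (hdiag : ⨆ μ : K, adDegree K s μ = ⊤) {c : K} {e : L} (he : e ∈ adDegree K s c) (he0 : e ≠ 0)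
    (hen : IsNilpotent (LieAlgebra.ad K L e)) :
    ∃ f ∈ adDegree K s (-c), IsSl2Triple ⁅e, f⁆ e f := by
  classical
  exact exists_mem_isSl2Triple_of_isInternal (𝔤 := fun μ : K ↦ adDegree K s μ) (isInternal_adDegree hdiag)
    (fun _ _ _ hx _ hy ↦ lie_mem_adDegree hx hy) he he0 hen

/-- **(5.2) for `𝔰 = Ks` and a non-zero weight `c`** — no nilpotency hypothesis: every non-zero `e` with
`⁅s, e⁆ = c • e`, `c ≠ 0`, lies in an `𝔰𝔩₂`-triple `(e, [e, f], f)` with `⁅s, f⁆ = -c • f`.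
[cite: LooijengaLunts1997, §5 (5.2) Lemma p. 20 L108–L121, (5.3) p. 21 L17–L19] -/
theorem exists_mem_adDegree_isSl2Triple_of_ne_zero [LieAlgebra.HasTrivialRadical K L] {s : L}
    (hdiag : ⨆ μ : K, adDegree K s μ = ⊤) {c : K} (hc : c ≠ 0) {e : L} (he : e ∈ adDegree K s c) (he0 : e ≠ 0) :
    ∃ f ∈ adDegree K s (-c), IsSl2Triple ⁅e, f⁆ e f :=
  exists_mem_adDegree_isSl2Triple hdiag he he0 (isNilpotent_ad_of_mem_adDegree hc he)

/-- … and conversely the weight of the third member is forced: for an `𝔰𝔩₂`-triple `(e, h, f)` with `e ∈ 𝔤_c` and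
`h ∈ 𝔤₀` (for a diagonalisable `ad s`), `f ∈ 𝔤_{-c}`. [cite: LooijengaLunts1997, §5 (5.2) proof, p. 20 L120–L121] -/
theorem mem_adDegree_neg_of_isSl2Triple {s : L} (hdiag : ⨆ μ : K, adDegree K s μ = ⊤) {c : K} {h e f : L}
    (t : IsSl2Triple h e f) (he : e ∈ adDegree K s c) (hh : h ∈ adDegree K s 0) : f ∈ adDegree K s (-c) := by
  classical
  exact mem_neg_of_isSl2Triple_of_isInternal (𝔤 := fun μ : K ↦ adDegree K s μ) (isInternal_adDegree hdiag)
    (fun _ _ _ hx _ hy ↦ lie_mem_adDegree hx hy) t he hh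

end OneElement

/-! ### §4 The printed setting: a commuting family of semisimple elements and its characters -/

section Diagonalisable

variable {K : Type*} [Field K] {V : Type*} [AddCommGroup V] [Module K V]

/-- Plumbing: on the `ν`-eigenspace, `(T - μ)^n` is the scalar `(ν - μ)^n`. [folklore] -/
private theorem pow_sub_apply_of_mem_eigenspace {T : Module.End K V} {ν μ : K} {x : V}
    (hx : x ∈ T.eigenspace ν) (n : ℕ) : ((T - μ • (1 : Module.End K V)) ^ n) x = (ν - μ) ^ n • x := by
  induction n with
  | zero => rw [pow_zero, pow_zero, one_smul, Module.End.one_apply]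
  | succ n ih =>
    have h1 : (T - μ • (1 : Module.End K V)) x = (ν - μ) • x := by
      rw [LinearMap.sub_apply, Module.End.mem_eigenspace_iff.1 hx, LinearMap.smul_apply, Module.End.one_apply,
        sub_smul]
    rw [pow_succ, Module.End.mul_apply, h1, map_smul, ih, smul_smul, ← pow_succ']

/-- **A diagonalisable endomorphism has no generalised eigenvectors beyond eigenvectors**: if `⨆ μ, E_μ(T) = V` then
`maxGenEigenspace T μ = E_μ(T)` for every `μ` (decompose a generalised eigenvector along `V = ⨁ E_ν`: on `E_ν` the
operator `(T - μ)^k` is the scalar `(ν - μ)^k`, non-zero for `ν ≠ μ`) — "semisimple elements" have honest weight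
spaces. [cite: LooijengaLunts1997, §5 (5.2) p. 20 L109–L110 ("consisting of semisimple elements")] -/
theorem maxGenEigenspace_eq_eigenspace_of_iSup_eigenspace_eq_top {T : Module.End K V}
    (hdiag : ⨆ μ : K, T.eigenspace μ = ⊤) (μ : K) : T.maxGenEigenspace μ = T.eigenspace μ := by
  classical
  refine le_antisymm (fun m hm ↦ ?_) Module.End.eigenspace_le_maxGenEigenspace
  have hint : DirectSum.IsInternal fun ν : K ↦ T.eigenspace ν :=
    DirectSum.isInternal_submodule_of_iSupIndep_of_iSup_eq_top T.eigenspaces_iSupIndep hdiag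
  letI := hint.chooseDecomposition
  obtain ⟨k, hk⟩ := (Module.End.mem_maxGenEigenspace T μ m).1 hm
  -- `(T - μ)^k` has degree `0` for the grading of `V` by the eigenspaces of `T`
  have hdeg : ∀ ν, ∀ x ∈ T.eigenspace ν,
      ((T - μ • (1 : Module.End K V)) ^ k) x ∈ (fun ν : K ↦ T.eigenspace ν) ((0 : K) + ν) := by
    intro ν x hx
    rw [zero_add, pow_sub_apply_of_mem_eigenspace hx]
    exact Submodule.smul_mem _ _ hx
  -- so the components of `m` outside `E_μ` vanish
  have hcomp : ∀ ν, ν ≠ μ → (DirectSum.decompose (fun ν : K ↦ T.eigenspace ν) m ν : V) = 0 := by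
    intro ν hν
    have h1 := coe_decompose_apply_add (fun ν : K ↦ T.eigenspace ν) ((T - μ • (1 : Module.End K V)) ^ k)
      (χ := 0) hdeg m ν
    rw [zero_add, hk, DirectSum.decompose_zero, DirectSum.zero_apply, ZeroMemClass.coe_zero,
      pow_sub_apply_of_mem_eigenspace (DirectSum.decompose (fun ν : K ↦ T.eigenspace ν) m ν).2] at h1
    exact (smul_eq_zero.1 h1.symm).resolve_left (pow_ne_zero _ (sub_ne_zero.2 hν))
  rw [← DirectSum.sum_support_decompose (fun ν : K ↦ T.eigenspace ν) m]
  refine Submodule.sum_mem _ fun ν _ ↦ ?_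
  by_cases hν : ν = μ
  · subst hν; exact (DirectSum.decompose (fun ν : K ↦ T.eigenspace ν) m ν).2
  · rw [hcomp ν hν]; exact Submodule.zero_mem _

end Diagonalisable

section Family

variable {K : Type*} [Field K] [CharZero K] {L : Type*} [LieRing L] [LieAlgebra K L] [FiniteDimensional K L]
  {ι : Type*}

omit [CharZero K] [FiniteDimensional K L] in
/-- Plumbing: commuting elements have commuting `ad`'s (`ad` is a Lie homomorphism). [folklore] -/
private theorem commute_ad_of_lie_eq_zero {x y : L} (hxy : ⁅x, y⁆ = 0) :
    Commute (LieAlgebra.ad K L x) (LieAlgebra.ad K L y) := by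
  change LieAlgebra.ad K L x * LieAlgebra.ad K L y = LieAlgebra.ad K L y * LieAlgebra.ad K L x
  refine LinearMap.ext fun z ↦ ?_
  rw [Module.End.mul_apply, Module.End.mul_apply, LieAlgebra.ad_apply, LieAlgebra.ad_apply, LieAlgebra.ad_apply,
    LieAlgebra.ad_apply, leibniz_lie, hxy, zero_lie, zero_add]

omit [CharZero K] in
/-- **The characters of a commuting family of split semisimple elements GRADE `L`**: for `s : ι → L` with
`⁅s i, s j⁆ = 0` and each `ad (s i)` diagonalisable over `K`, `L = ⨁_{χ : ι → K} 𝔤^χ` with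
`𝔤^χ = ⨅ i, adDegree K (s i) (χ i)` the simultaneous eigenspaces (Mathlib's simultaneous-eigenspace theorems
`Module.End.independent_iInf_maxGenEigenspace_of_forall_mapsTo`,
`Module.End.iSup_iInf_maxGenEigenspace_eq_top_of_iSup_maxGenEigenspace_eq_top_of_commute`, the generalised eigenspaces
being eigenspaces by `maxGenEigenspace_eq_eigenspace_of_iSup_eigenspace_eq_top`).
[cite: LooijengaLunts1997, §5 (5.2) p. 20 L109–L111 ("𝔰 ⊂ 𝔤 a commutative subalgebra consisting of semisimple elements and χ ∈ 𝔰^* a character of 𝔰 in 𝔤")] -/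
theorem isInternal_iInf_adDegree [DecidableEq (ι → K)] {s : ι → L} (hcomm : ∀ i j, ⁅s i, s j⁆ = 0)
    (hdiag : ∀ i, ⨆ μ : K, adDegree K (s i) μ = ⊤) :
    DirectSum.IsInternal fun χ : ι → K ↦ ⨅ i, adDegree K (s i) (χ i) := by
  have hmax : ∀ i (μ : K), (LieAlgebra.ad K L (s i)).maxGenEigenspace μ = adDegree K (s i) μ :=
    fun i μ ↦ maxGenEigenspace_eq_eigenspace_of_iSup_eigenspace_eq_top (hdiag i) μ
  have hc : ∀ i j, Commute (LieAlgebra.ad K L (s i)) (LieAlgebra.ad K L (s j)) :=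
    fun i j ↦ commute_ad_of_lie_eq_zero (hcomm i j)
  refine DirectSum.isInternal_submodule_of_iSupIndep_of_iSup_eq_top ?_ ?_
  · have h1 := Module.End.independent_iInf_maxGenEigenspace_of_forall_mapsTo (fun i ↦ LieAlgebra.ad K L (s i))
      (fun i j φ ↦ Module.End.mapsTo_maxGenEigenspace_of_comm (hc j i) φ)
    simp only [hmax] at h1
    exact h1
  · have h1 := Module.End.iSup_iInf_maxGenEigenspace_eq_top_of_iSup_maxGenEigenspace_eq_top_of_commute
      (fun i ↦ LieAlgebra.ad K L (s i)) (fun i j _ ↦ hc i j) (fun i ↦ by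
        rw [eq_top_iff, ← hdiag i]
        exact iSup_mono fun μ ↦ Module.End.eigenspace_le_maxGenEigenspace)
    simp only [hmax] at h1
    exact h1

omit [CharZero K] [FiniteDimensional K L] in
/-- `⁅𝔤^α, 𝔤^β⁆ ⊆ 𝔤^{α+β}` for the simultaneous eigenspaces of a family (componentwise `lie_mem_adDegree`).
[cite: LooijengaLunts1997, §5 (5.2) p. 20 L109–L111] -/
theorem lie_mem_iInf_adDegree {s : ι → L} {α β : ι → K} {x y : L} (hx : x ∈ ⨅ i, adDegree K (s i) (α i))
    (hy : y ∈ ⨅ i, adDegree K (s i) (β i)) : ⁅x, y⁆ ∈ ⨅ i, adDegree K (s i) ((α + β) i) := by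
  rw [Submodule.mem_iInf] at hx hy ⊢
  exact fun i ↦ lie_mem_adDegree (hx i) (hy i)

/-- **LEMMA (5.2) AS PRINTED (split form).**  Let `L` be a finite-dimensional semisimple Lie algebra over a field of
characteristic `0`, `s : ι → L` a commuting family of elements with each `ad (s i)` diagonalisable over `K` ("`𝔰 ⊂ 𝔤` a
commutative subalgebra consisting of semisimple elements"; `𝔰 = span s`) and `χ : ι → K` ("a character of `𝔰`", given
by its values on `s`).  Then for every non-zero `ad`-nilpotent `e ∈ 𝔤^χ = ⨅ i, adDegree K (s i) (χ i)` there is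
`f ∈ 𝔤^{-χ}` such that `(e, [e, f], f)` is an `𝔰𝔩₂`-triple. [cite: LooijengaLunts1997, §5 (5.2) Lemma, p. 20 L108–L121] -/
theorem exists_mem_iInf_adDegree_isSl2Triple [LieAlgebra.HasTrivialRadical K L] {s : ι → L}
    (hcomm : ∀ i j, ⁅s i, s j⁆ = 0) (hdiag : ∀ i, ⨆ μ : K, adDegree K (s i) μ = ⊤) (χ : ι → K) {e : L}
    (he : e ∈ ⨅ i, adDegree K (s i) (χ i)) (he0 : e ≠ 0) (hen : IsNilpotent (LieAlgebra.ad K L e)) :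
    ∃ f ∈ ⨅ i, adDegree K (s i) (-χ i), IsSl2Triple ⁅e, f⁆ e f := by
  classical
  exact exists_mem_isSl2Triple_of_isInternal (𝔤 := fun χ : ι → K ↦ ⨅ i, adDegree K (s i) (χ i))
    (isInternal_iInf_adDegree hcomm hdiag) (fun _ _ _ hx _ hy ↦ lie_mem_iInf_adDegree hx hy) he he0 hen

/-- (5.2) as printed, with the weights of `h = [e, f]` (`= 0`) and `f` (`= -χ`) displayed.
[cite: LooijengaLunts1997, §5 (5.2) Lemma, p. 20 L108–L121] -/
theorem exists_mem_iInf_adDegree_zero_isSl2Triple [LieAlgebra.HasTrivialRadical K L] {s : ι → L}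
    (hcomm : ∀ i j, ⁅s i, s j⁆ = 0) (hdiag : ∀ i, ⨆ μ : K, adDegree K (s i) μ = ⊤) (χ : ι → K) {e : L}
    (he : e ∈ ⨅ i, adDegree K (s i) (χ i)) (he0 : e ≠ 0) (hen : IsNilpotent (LieAlgebra.ad K L e)) :
    ∃ h ∈ ⨅ i, adDegree K (s i) 0, ∃ f ∈ ⨅ i, adDegree K (s i) (-χ i), IsSl2Triple h e f := by
  obtain ⟨f, hf, t⟩ := exists_mem_iInf_adDegree_isSl2Triple hcomm hdiag χ he he0 hen
  refine ⟨⁅e, f⁆, ?_, f, hf, t⟩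
  have h1 := lie_mem_iInf_adDegree (α := χ) (β := -χ) he hf
  rwa [add_neg_cancel] at h1

/-- If some weight `χ i` is non-zero, `e ∈ 𝔤^χ` is automatically `ad`-nilpotent, and (5.2) needs no nilpotency
hypothesis. [cite: LooijengaLunts1997, §5 (5.2) Lemma, p. 20 L108–L121] -/
theorem exists_mem_iInf_adDegree_isSl2Triple_of_ne_zero [LieAlgebra.HasTrivialRadical K L] {s : ι → L}
    (hcomm : ∀ i j, ⁅s i, s j⁆ = 0) (hdiag : ∀ i, ⨆ μ : K, adDegree K (s i) μ = ⊤) (χ : ι → K) {i₀ : ι}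
    (hχ : χ i₀ ≠ 0) {e : L} (he : e ∈ ⨅ i, adDegree K (s i) (χ i)) (he0 : e ≠ 0) :
    ∃ f ∈ ⨅ i, adDegree K (s i) (-χ i), IsSl2Triple ⁅e, f⁆ e f :=
  exists_mem_iInf_adDegree_isSl2Triple hcomm hdiag χ he he0
    (isNilpotent_ad_of_mem_adDegree hχ ((Submodule.mem_iInf _).1 he i₀))

/-- The weight of the third member is forced here too: an `𝔰𝔩₂`-triple `(e, h, f)` with `e ∈ 𝔤^χ`, `h ∈ 𝔤^0` has
`f ∈ 𝔤^{-χ}`. [cite: LooijengaLunts1997, §5 (5.2) proof, p. 20 L120–L121] -/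
theorem mem_iInf_adDegree_neg_of_isSl2Triple {s : ι → L} (hcomm : ∀ i j, ⁅s i, s j⁆ = 0)
    (hdiag : ∀ i, ⨆ μ : K, adDegree K (s i) μ = ⊤) (χ : ι → K) {h e f : L} (t : IsSl2Triple h e f)
    (he : e ∈ ⨅ i, adDegree K (s i) (χ i)) (hh : h ∈ ⨅ i, adDegree K (s i) 0) :
    f ∈ ⨅ i, adDegree K (s i) (-χ i) := by
  classical
  exact mem_neg_of_isSl2Triple_of_isInternal (𝔤 := fun χ : ι → K ↦ ⨅ i, adDegree K (s i) (χ i))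
    (isInternal_iInf_adDegree hcomm hdiag) (fun _ _ _ hx _ hy ↦ lie_mem_iInf_adDegree hx hy) t he
    (by simpa only [Pi.zero_apply] using hh)

end Family

/-! ### §5 Lefschetz triples: homogeneous `𝔰𝔩₂`-triples through elements of non-zero degree -/

section LefschetzTriples

variable {K : Type*} [Field K] [CharZero K] {L : Type*} [LieRing L] [LieAlgebra K L] [FiniteDimensional K L]
  {h : L} {𝔞 : Submodule K L}

omit [CharZero K] [FiniteDimensional K L] in
/-- For a Lefschetz triple `(𝔤, h, 𝔞)` the grading by `ad h` exhausts `𝔤` (`⨆_{μ ∈ K} 𝔤_μ = 𝔤`; indeed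
`𝔤 = ⨁_{k ∈ ℤ} 𝔤_{2k}`, A1-84 `IsLefschetzTriple.iSup_adDegree_even_eq_top`). [cite: LooijengaLunts1997, §1 p. 7 L91–L93] -/
theorem IsLefschetzTriple.iSup_adDegree_eq_top (T : IsLefschetzTriple K h 𝔞) : ⨆ μ : K, adDegree K h μ = ⊤ := by
  rw [eq_top_iff, ← T.iSup_adDegree_even_eq_top]
  exact iSup_le fun k ↦ le_iSup (fun μ : K ↦ adDegree K h μ) (2 * (k : K))

/-- **Homogeneous `𝔰𝔩₂`-triples in a Lefschetz triple ((5.2) with `𝔰 = Kh`, the form used in (5.3)):** in a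
Lefschetz triple `(𝔤, h, 𝔞)` every non-zero `x ∈ 𝔤_c` of non-zero degree `c` is the nil-positive element of an
`𝔰𝔩₂`-triple `(x, [x, f], f)` with `f ∈ 𝔤_{-c}` and `[x, f] ∈ 𝔤₀` — e.g. every non-zero `x ∈ 𝔤₂`, Lefschetz or not,
has such a partner of degree `-2` ("we find an `𝔰𝔩₂`-triple `(e_a, h_hor, f_a)` in `𝔤(𝔞, M)` with `f_a` of total degree
`-2` and `h_hor` of total degree `0`"; for a LEFSCHETZ `x ∈ 𝔞` the triple is `(x, h, f_x)` itself).
[cite: LooijengaLunts1997, §5 (5.2) p. 20 L108–L121, (5.3) p. 21 L17–L19] -/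
theorem IsLefschetzTriple.exists_mem_adDegree_isSl2Triple (T : IsLefschetzTriple K h 𝔞) {c : K} (hc : c ≠ 0)
    {x : L} (hx : x ∈ adDegree K h c) (hx0 : x ≠ 0) :
    ∃ f ∈ adDegree K h (-c), ⁅x, f⁆ ∈ adDegree K h 0 ∧ IsSl2Triple ⁅x, f⁆ x f := by
  haveI := T.isSemisimple
  obtain ⟨f, hf, t⟩ := exists_mem_adDegree_isSl2Triple_of_ne_zero T.iSup_adDegree_eq_top hc hx hx0
  refine ⟨f, hf, ?_, t⟩
  have h1 := lie_mem_adDegree hx hf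
  rwa [add_neg_cancel] at h1

/-- In particular for a Jordan–Lefschetz pair `(𝔤, h)` (`𝔤 = 𝔤₋₂ ⊕ 𝔤₀ ⊕ 𝔤₂`): EVERY non-zero `x ∈ 𝔤₂` lies in an
`𝔰𝔩₂`-triple `(x, [x, f], f)` with `f ∈ 𝔤₋₂`. [cite: LooijengaLunts1997, §5 (5.2) p. 20 L108–L121, §2 (2.2) p. 9] -/
theorem IsJordanLefschetzPair.exists_mem_adDegree_isSl2Triple (J : IsJordanLefschetzPair K h) {x : L}
    (hx : x ∈ adDegree K h 2) (hx0 : x ≠ 0) :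
    ∃ f ∈ adDegree K h (-2), ⁅x, f⁆ ∈ adDegree K h 0 ∧ IsSl2Triple ⁅x, f⁆ x f :=
  J.isLefschetzTriple.exists_mem_adDegree_isSl2Triple two_ne_zero hx hx0

end LefschetzTriples

/-! ### §6 The printed hypothesis "reductive" (`LieAlgebra.HasCentralRadical`, Bourbaki I §6 no. 4) -/

section Reductive

variable {K : Type*} [Field K] [CharZero K] {L : Type*} [LieRing L] [LieAlgebra K L] [FiniteDimensional K L]

/-- **Jacobson–Morozov in a REDUCTIVE Lie algebra** (`LieAlgebra.HasCentralRadical`, Mathlib's name for Bourbaki's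
"reductive": `rad 𝔤 = 𝔷(𝔤)`): a non-zero `ad`-nilpotent element `e` of the derived algebra `𝒟𝔤` lies in an
`𝔰𝔩₂`-triple of `𝔤` — Jacobson–Morozov (the tree's `exists_isSl2Triple_of_isNilpotent_ad`) in the semisimple ideal
`𝒟𝔤` (the tree's `isKilling_derivedSeries_of_hasCentralRadical`, Bourbaki I §6 no. 4 Prop. 5 (b)).  The hypothesis
`e ∈ 𝒟𝔤` is what "nilpotent element of a reductive Lie algebra" means (a non-zero CENTRAL `z` is `ad`-nilpotent but
`e = ½[h, e] ∈ 𝒟𝔤` for every triple); it is automatic for elements of non-zero weight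
(`mem_derivedSeries_of_mem_adDegree`). [cite: LooijengaLunts1997, §5 (5.2) Lemma p. 20 L108–L113 ("Let 𝔤 be a reductive Lie algebra … Choose an 𝔰𝔩₂-triple (e,h′,f′) containing e")] [cite: Bourbaki2008LieGroups79, Ch. VIII §11 no. 2 Prop. 2] -/
theorem exists_isSl2Triple_of_hasCentralRadical [LieAlgebra.HasCentralRadical K L] {e : L}
    (heD : e ∈ LieAlgebra.derivedSeries K L 1) (he0 : e ≠ 0) (hen : IsNilpotent (LieAlgebra.ad K L e)) :
    ∃ h f : L, IsSl2Triple h e f := by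
  haveI := isKilling_derivedSeries_of_hasCentralRadical (k := K) (L := L)
  set D := LieAlgebra.derivedSeries K L 1 with hD
  -- `ad_D e` is nilpotent along with `ad_L e`
  have key : ∀ (m : ℕ) (x : D),
      ((((LieAlgebra.ad K D ⟨e, heD⟩) ^ m) x : D) : L) = ((LieAlgebra.ad K L e) ^ m) (x : L) := by
    intro m
    induction m with
    | zero => intro x; rw [pow_zero, pow_zero, Module.End.one_apply, Module.End.one_apply]
    | succ m ih =>
      intro x
      rw [pow_succ', Module.End.mul_apply, LieAlgebra.ad_apply, pow_succ', Module.End.mul_apply, LieAlgebra.ad_apply,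
        ← ih x]
      rfl
  have hnil : IsNilpotent (LieAlgebra.ad K D ⟨e, heD⟩) := by
    obtain ⟨n, hn⟩ := hen
    refine ⟨n, LinearMap.ext fun x ↦ Subtype.ext ?_⟩
    rw [key n x, hn, LinearMap.zero_apply, LinearMap.zero_apply, ZeroMemClass.coe_zero]
  have he0' : (⟨e, heD⟩ : D) ≠ 0 := fun h0 ↦ he0 (congrArg Subtype.val h0)
  obtain ⟨h', f', t'⟩ := exists_isSl2Triple_of_isNilpotent_ad he0' hnil
  refine ⟨(h' : L), (f' : L), ?_⟩
  -- the inclusion `𝒟𝔤 ↪ 𝔤` is a morphism of Lie algebras (all coercions are definitional)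
  exact
    { h_ne_zero := fun h0 ↦ t'.h_ne_zero (Subtype.ext h0)
      lie_e_f := congrArg Subtype.val t'.lie_e_f
      lie_h_e_nsmul := congrArg Subtype.val t'.lie_h_e_nsmul
      lie_h_f_nsmul := congrArg Subtype.val t'.lie_h_f_nsmul }

omit [CharZero K] [FiniteDimensional K L] in
/-- An element of non-zero weight lies in the derived algebra: `⁅s, e⁆ = c • e`, `c ≠ 0 ⟹ e = c⁻¹ • ⁅s, e⁆ ∈ 𝒟𝔤` —
so for `χ ≠ 0` the printed "nilpotent `e ∈ 𝔤^χ`" of a reductive `𝔤` is automatically an element of `𝒟𝔤`.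
[cite: LooijengaLunts1997, §5 (5.2) p. 20 L111] -/
theorem mem_derivedSeries_of_mem_adDegree {s e : L} {c : K} (hc : c ≠ 0) (he : e ∈ adDegree K s c) :
    e ∈ LieAlgebra.derivedSeries K L 1 := by
  have h1 : e = c⁻¹ • ⁅s, e⁆ := by rw [mem_adDegree_iff.1 he, smul_smul, inv_mul_cancel₀ hc, one_smul]
  rw [h1, LieAlgebra.derivedSeries_def, LieAlgebra.derivedSeriesOfIdeal_succ, LieAlgebra.derivedSeriesOfIdeal_zero]
  exact Submodule.smul_mem _ _ (LieSubmodule.lie_mem_lie (LieSubmodule.mem_top s) (LieSubmodule.mem_top e))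

variable {Γ : Type*} [DecidableEq Γ] [AddCommGroup Γ] (𝔤 : Γ → Submodule K L)

/-- **LEMMA (5.2) FOR A REDUCTIVE `𝔤`, AS PRINTED** (grading as a `GradedLieAlgebra 𝔤` of Mathlib): `L` finite-dimensional
reductive (`HasCentralRadical`) over a field of characteristic `0`, `e ∈ 𝔤 χ` a non-zero `ad`-nilpotent element of
`𝒟𝔤` `⟹ ∃ f ∈ 𝔤 (-χ)` with `(e, [e, f], f)` an `𝔰𝔩₂`-triple ("Choose an `𝔰𝔩₂`-triple `(e, h', f')` containing `e`" —
`exists_isSl2Triple_of_hasCentralRadical` — then the graded refinement `exists_mem_isSl2Triple_of_isSl2Triple`).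
[cite: LooijengaLunts1997, §5 (5.2) Lemma, p. 20 L108–L121] -/
theorem exists_mem_isSl2Triple_of_hasCentralRadical [LieAlgebra.HasCentralRadical K L] [GradedLieAlgebra 𝔤] {χ : Γ}
    {e : L} (he : e ∈ 𝔤 χ) (heD : e ∈ LieAlgebra.derivedSeries K L 1) (he0 : e ≠ 0)
    (hen : IsNilpotent (LieAlgebra.ad K L e)) : ∃ f ∈ 𝔤 (-χ), IsSl2Triple ⁅e, f⁆ e f := by
  obtain ⟨h', f', t'⟩ := exists_isSl2Triple_of_hasCentralRadical heD he0 hen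
  exact exists_mem_isSl2Triple_of_isSl2Triple 𝔤 t' he

variable {𝔤} in
/-- (5.2) for a reductive `𝔤` and a grading given by `Prop`-level data (`DirectSum.IsInternal` + bracket compatibility).
[cite: LooijengaLunts1997, §5 (5.2) Lemma, p. 20 L108–L121] -/
theorem exists_mem_isSl2Triple_of_hasCentralRadical_of_isInternal [LieAlgebra.HasCentralRadical K L]
    (hint : DirectSum.IsInternal 𝔤) (hmul : ∀ α β : Γ, ∀ x ∈ 𝔤 α, ∀ y ∈ 𝔤 β, ⁅x, y⁆ ∈ 𝔤 (α + β))
    {χ : Γ} {e : L} (he : e ∈ 𝔤 χ) (heD : e ∈ LieAlgebra.derivedSeries K L 1) (he0 : e ≠ 0)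
    (hen : IsNilpotent (LieAlgebra.ad K L e)) : ∃ f ∈ 𝔤 (-χ), IsSl2Triple ⁅e, f⁆ e f := by
  letI : GradedLieAlgebra 𝔤 :=
    { toDecomposition := hint.chooseDecomposition, bracket_mem := @fun α β x y hx hy ↦ hmul α β x hx y hy }
  exact exists_mem_isSl2Triple_of_hasCentralRadical 𝔤 he heD he0 hen

variable {ι : Type*}

/-- **LEMMA (5.2) VERBATIM (split form): "Let `𝔤` be a reductive Lie algebra, `𝔰 ⊂ 𝔤` a commutative subalgebra consisting
of semisimple elements and `χ ∈ 𝔰^*` a character of `𝔰` in `𝔤`. Then for every nilpotent `e ∈ 𝔤^χ` there exists a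
`f ∈ 𝔤^{-χ}` such that `(e, [e, f], f)` is an `𝔰𝔩(2)`-triple."** — `𝔰` spanned by a commuting family `s : ι → L` with
each `ad (s i)` diagonalisable over `K`, `χ : ι → K` its values on `s`, `𝔤^χ = ⨅ i, adDegree K (s i) (χ i)`; "nilpotent"
= non-zero, `ad`-nilpotent, in `𝒟𝔤`. [cite: LooijengaLunts1997, §5 (5.2) Lemma, p. 20 L108–L121] -/
theorem exists_mem_iInf_adDegree_isSl2Triple_of_hasCentralRadical [LieAlgebra.HasCentralRadical K L] {s : ι → L}
    (hcomm : ∀ i j, ⁅s i, s j⁆ = 0) (hdiag : ∀ i, ⨆ μ : K, adDegree K (s i) μ = ⊤) (χ : ι → K) {e : L}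
    (he : e ∈ ⨅ i, adDegree K (s i) (χ i)) (heD : e ∈ LieAlgebra.derivedSeries K L 1) (he0 : e ≠ 0)
    (hen : IsNilpotent (LieAlgebra.ad K L e)) :
    ∃ f ∈ ⨅ i, adDegree K (s i) (-χ i), IsSl2Triple ⁅e, f⁆ e f := by
  classical
  exact exists_mem_isSl2Triple_of_hasCentralRadical_of_isInternal (𝔤 := fun χ : ι → K ↦ ⨅ i, adDegree K (s i) (χ i))
    (isInternal_iInf_adDegree hcomm hdiag) (fun _ _ _ hx _ hy ↦ lie_mem_iInf_adDegree hx hy) he heD he0 hen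

/-- … and with a non-zero weight `χ i₀ ≠ 0` both "nilpotent" and "`e ∈ 𝒟𝔤`" are automatic: every non-zero `e ∈ 𝔤^χ`
of a reductive `𝔤` lies in an `𝔰𝔩₂`-triple `(e, [e, f], f)` with `f ∈ 𝔤^{-χ}`. [cite: LooijengaLunts1997, §5 (5.2) Lemma, p. 20 L108–L121] -/
theorem exists_mem_iInf_adDegree_isSl2Triple_of_hasCentralRadical_of_ne_zero [LieAlgebra.HasCentralRadical K L]
    {s : ι → L} (hcomm : ∀ i j, ⁅s i, s j⁆ = 0) (hdiag : ∀ i, ⨆ μ : K, adDegree K (s i) μ = ⊤) (χ : ι → K)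
    {i₀ : ι} (hχ : χ i₀ ≠ 0) {e : L} (he : e ∈ ⨅ i, adDegree K (s i) (χ i)) (he0 : e ≠ 0) :
    ∃ f ∈ ⨅ i, adDegree K (s i) (-χ i), IsSl2Triple ⁅e, f⁆ e f :=
  have hei : e ∈ adDegree K (s i₀) (χ i₀) := (Submodule.mem_iInf _).1 he i₀
  exists_mem_iInf_adDegree_isSl2Triple_of_hasCentralRadical hcomm hdiag χ he
    (mem_derivedSeries_of_mem_adDegree hχ hei) he0 (isNilpotent_ad_of_mem_adDegree hχ hei)

/-- The one-element case for a reductive `𝔤` (`𝔰 = Ks`, `c ≠ 0`): every non-zero `e` with `⁅s, e⁆ = c • e` lies in an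
`𝔰𝔩₂`-triple `(e, [e, f], f)` with `⁅s, f⁆ = -c • f`. [cite: LooijengaLunts1997, §5 (5.2) Lemma p. 20 L108–L121, (5.3) p. 21 L17–L19] -/
theorem exists_mem_adDegree_isSl2Triple_of_hasCentralRadical [LieAlgebra.HasCentralRadical K L] {s : L}
    (hdiag : ⨆ μ : K, adDegree K s μ = ⊤) {c : K} (hc : c ≠ 0) {e : L} (he : e ∈ adDegree K s c) (he0 : e ≠ 0) :
    ∃ f ∈ adDegree K s (-c), IsSl2Triple ⁅e, f⁆ e f := by
  classical
  exact exists_mem_isSl2Triple_of_hasCentralRadical_of_isInternal (𝔤 := fun μ : K ↦ adDegree K s μ)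
    (isInternal_adDegree hdiag) (fun _ _ _ hx _ hy ↦ lie_mem_adDegree hx hy) he
    (mem_derivedSeries_of_mem_adDegree hc he) he0 (isNilpotent_ad_of_mem_adDegree hc he)

end Reductive

end Literature.Algebra.Lie
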